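import Literature.AlgebraicGeometry.HodgeTheory.LefschetzOneOneHeartOfCechIntegral
import Literature.AlgebraicGeometry.HodgeTheory.LefschetzOneOneCechIntegrality
import HarnessLib

/-!
# Lefschetz's theorem on `(1,1)`-classes from the existence of sections alone

Family `hodge`, layer `Literature/AlgebraicGeometry/HodgeTheory`. Assembly of the named fact
`Literature.AlgebraicGeometry.HodgeTheory.lefschetzOneOne_rational` (`LefschetzOneOne.lean`: a
rational class of Hodge type `(1,1)` on a smooth projective complex variety is a `ℚ`-combination
of divisor classes; Voisin (2002), §11.3.2: "The case `k = 1` of this conjecture holds by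
theorem 11.30 and corollary 11.34") with the Čech integrality step now PROVED
(`CechCocycleIntegral_holds`, `LefschetzOneOneCechIntegrality`): the heart
`lefschetzOneOne_rational_of_cechIntegral_of_isTrivialOn` (`LefschetzOneOneHeartOfCechIntegral`:
Weil–Kostant construction of the line bundle, rigidity of natural comparison families, Chow's
theorem, universal coefficients — all theorems of the tree) leaves exactly ONE input, the
meromorphic-section lemma of the proof of Cor. 11.34:

* `lefschetzOneOne_rational_of_isTrivialOn` — from `h₂`: every cocycle holomorphic line bundle on
  a Hodge model of a smooth projective variety is trivial off a proper analytic subset;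
* `lefschetzOneOne_rational_of_globalSections` — from the Kodaira–Serre existence of sections
  alone (`h`: some `L'` with non-zero global sections of `L ⊗ L'` and of `L'`; Voisin (2002), proof
  of Cor. 11.34 via Thm. 7.11: `L' = H^{⊗N}`), the quotient `σ₁/σ₂` being the tree's
  `isTrivialOn_compl_analyticSet_of_globalSections`.

No named facts; everything is proved. The remaining hypothesis `h` (existence of non-zero
holomorphic sections of `L ⊗ H^{⊗N}`, `H^{⊗N}` for `N ≫ 0`: Kodaira's embedding theorem 7.11 /
Serre 1955) is not in the tree.

## References

* C. Voisin, *Hodge Theory and Complex Algebraic Geometry I* (2002), Thm. 7.11, Thm. 11.30,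
  Cor. 11.34 (proof), §11.3.2. [VoisinHodgeI2002]
-/

noncomputable section

open scoped Manifold ContDiff Topology
open Set
open Literature.Geometry.Kaehler
open Literature.NumberTheory.Transcendental
open Literature.AlgebraicTopology.SingularHomology (singularCohomology)

namespace Literature.AlgebraicGeometry.HodgeTheory

/-- **Lefschetz's theorem on `(1,1)`-classes with `ℚ`-coefficients from the meromorphic-section
lemma `h₂` alone**: every holomorphic line bundle on (a Hodge model of) a smooth projective variety
is trivial off a proper analytic subset (Voisin (2002), Cor. 11.34, proof). The Čech integrality
step is `CechCocycleIntegral_holds`; the rest is `lefschetzOneOne_rational_of_cechIntegral_of_isTrivialOn`.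
[cite: VoisinHodgeI2002, §11.3.2 (remark after Conj. 11.36), Thm. 11.30 and Cor. 11.34 (proof)] -/
theorem lefschetzOneOne_rational_of_isTrivialOn
    (h₂ : ∀ ⦃n : ℕ⦄ ⦃X : Motives.SchemeOver ℂ⦄, Motives.IsSmoothProjective n X → ∀ (A : HodgeModel n X)
      (ι : Type) (L : HolomorphicLineBundle ι A.model A.carrier),
      ∃ S : Set A.carrier, IsAnalyticSet 𝓘(ℂ, A.model) S ∧ S ≠ Set.univ ∧ L.IsTrivialOn Sᶜ) :
    lefschetzOneOne_rational :=
  lefschetzOneOne_rational_of_cechIntegral_of_isTrivialOn CechCocycleIntegral_holds h₂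

/-- **Lefschetz's theorem on `(1,1)`-classes with `ℚ`-coefficients from the existence of sections
alone** (the Kodaira–Serre input of the proof of Cor. 11.34: for every cocycle line bundle `L` on a
Hodge model of a smooth projective variety, some cocycle line bundle `L'` with non-zero global
sections `σ₁` of `L ⊗ L'` and `σ₂` of `L'` — printed with `L' = H^{⊗N}`, `H` ample, `N ≫ 0`,
Thm. 7.11). The meromorphic section `σ₁/σ₂` (`isTrivialOn_compl_analyticSet_of_globalSections`), the
Čech integrality step (`CechCocycleIntegral_holds`) and everything downstream are proved.
[cite: VoisinHodgeI2002, Cor. 11.34 (proof) and Thm. 7.11] -/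
theorem lefschetzOneOne_rational_of_globalSections
    (h : ∀ ⦃n : ℕ⦄ ⦃X : Motives.SchemeOver ℂ⦄, Motives.IsSmoothProjective n X → ∀ (A : HodgeModel n X)
      (ι : Type) (L : HolomorphicLineBundle ι A.model A.carrier),
      ∃ (κ : Type) (L' : HolomorphicLineBundle κ A.model A.carrier)
        (σ₁ : (L.tensor L').GlobalSection) (σ₂ : L'.GlobalSection),
        σ₁.zeroSet ≠ Set.univ ∧ σ₂.zeroSet ≠ Set.univ) :
    lefschetzOneOne_rational :=
  lefschetzOneOne_rational_of_isTrivialOn (isTrivialOn_compl_analyticSet_of_globalSections h)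

end Literature.AlgebraicGeometry.HodgeTheory

end
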